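import Mathlib
import Summits.ResolutionOfSingularities.ResolutionOfSingularities.Theorems.HomologicalConductorPersistenceStaircaseRecords
import HarnessLib

/-!
# Rung S-2 `PersistenceSurface` (stmt-19970), stub C1 (`Sat₄`) — THE VERONESE CONES `1/n(1,1)`: for every `n ≥ 2`,
# `ca(k[u,v]^{μ_n(1,1)}) = ca⁴` and the centre is `s̲ann(M_{n−1})`, kernel-certified end to end
# (chain W4.4b, seat res-L1-w44b-stub-4 gen 6; T-V package part 23)

[OURS · L1 w44b · rung S-2] Nothing here is a statement of the manuscript under review (Hironaka 2017);
AI-written, weaker than expert review.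

The pipeline of parts 15–22 (Herzog cover → isotypic splitting → staircase resolutions → Ω-stable distinguished
family → res-L1-w44b-stub-2's recurrent-class saturation) is run UNIFORMLY on the family `q = 1`: the cones over
the rational normal curves, `U = k[u,v]^{μ_n} = k[uⁿ, uⁿ⁻¹v, …, vⁿ]` (`1/3(1,1)` = the cone over the twisted cubic is
the smallest non-Gorenstein surface singularity; `ζ` a primitive `n`-th root of unity, `n ∈ kˣ`, `n ≥ 2`).  For
`q = 1` the record staircase of the class `a` is `(a − s, s)_{s ≤ a}` and EVERY drop class is `−1 = n − 1`
(`Ω M_a ≅ M_{n−1}^{a}`; the `i`-series of `n/1` is `(1)`, the dual of the special `M_1` is `M_{n−1}`), so the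
distinguished family is the single piece `M_{n−1}`, Ω-stable (`M_{n−1} | Ω M_{n−1} = M_{n−1}^{n−1}`):

* **`cohomologyAnnihilator_veronese`** — for `n ≥ 2`: `ca(U) = ca⁴(U)` and `x ∈ ca(U) ↔ x ∈ s̲ann(M_{n−1})`
  (with the rank-one trace dictionary: `ca(U) = M_{n−1}·M_1 = 𝔪`, the irrelevant ideal — the classical value).
No hypothesis beyond the base-field arithmetic; no case analysis on `n`.  The first family of non-Gorenstein
surface singularities with `Sat₄` (`SaturationCompleteRationalNormal`) and the exact centre in the kernel.

References: folklore; res-L1-w44b-idea-1 SC-TORIC v2 (OURS, memo), control rows `1/3(1,1)`, `1/4(1,3)`….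
-/

-- single-problem summit: the doubled namespace component `ResolutionOfSingularities` is forced
set_option linter.dupNamespace false

noncomputable section

open CategoryTheory Literature.RingTheory.CohomologyAnnihilator MvPolynomial
open Summit.ResolutionOfSingularities.ResolutionOfSingularities.Theorems.NoZeno.SandwichCluster
open Summit.ResolutionOfSingularities.ResolutionOfSingularities.Theorems.HomologicalConductor.PersistenceAddCoverFamily
open Summit.ResolutionOfSingularities.ResolutionOfSingularities.Theorems.HomologicalConductor.PersistenceCyclicQuotientIsotypic
open Summit.ResolutionOfSingularities.ResolutionOfSingularities.Theorems.HomologicalConductor.PersistenceCyclicQuotientIsotypicPieces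
open Summit.ResolutionOfSingularities.ResolutionOfSingularities.Theorems.HomologicalConductor.PersistenceStaircaseRecords

universe u

namespace Summit.ResolutionOfSingularities.ResolutionOfSingularities.Theorems.HomologicalConductor.PersistenceCyclicQuotientVeronese

variable {k : Type u} [Field k] {n : ℕ} [NeZero n] (hn2 : 2 ≤ n) {ζ : k} (hζ : IsPrimitiveRoot ζ n)
variable (hn : (n : k) ≠ 0) (U : Subalgebra k (MvPolynomial (Fin 2) k))
variable (hU : ∀ p, p ∈ U ↔ aeval (fun i : Fin 2 => C (ζ ^ (![1, 1] : Fin 2 → ℕ) i) * X i) p = p)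

set_option maxHeartbeats 800000 in
set_option synthInstance.maxHeartbeats 400000 in
include hn2 hζ hn hU in
/-- **`Sat₄` and the exact centre for the Veronese cone `k[u,v]^{μ_n(1,1)}`, every `n ≥ 2`, kernel-certified.**
With the weight pieces `M a = {p | σ₀ p = ζ^a p}` (`σ₀ : u ↦ ζu, v ↦ ζv`): `ca(U) = ca⁴(U)` and
`x ∈ ca(U) ↔ x` stably annihilates `M_{−1} = M_{n−1}`.  (Budgets raised locally as in part 21: instance search for
modules of semi-invariants over the subalgebra `U`.) [OURS · L1 w44b] -/
theorem cohomologyAnnihilator_veronese :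
    ∃ M : ZMod n → Submodule U ((restrictScalarsFunctor U (MvPolynomial (Fin 2) k)).obj
        (ModuleCat.of (MvPolynomial (Fin 2) k) (MvPolynomial (Fin 2) k))),
      (∀ (a : ZMod n) (p : MvPolynomial (Fin 2) k),
        (show ((restrictScalarsFunctor U (MvPolynomial (Fin 2) k)).obj
          (ModuleCat.of (MvPolynomial (Fin 2) k) (MvPolynomial (Fin 2) k))) from p) ∈ M a ↔
        aeval (fun i : Fin 2 => C (ζ ^ (![1, 1] : Fin 2 → ℕ) i) * X i) p = C (ζ ^ a.val) * p) ∧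
      cohomologyAnnihilator U = cohomologyAnnihilatorOfDegree U 4 ∧
      ∀ x : U, x ∈ cohomologyAnnihilator U ↔
        StablyAnnihilates U x (@ModuleCat.of U _ (M (-1)) _ (M (-1)).module) := by
  classical
  have hq : Nat.Coprime 1 n := Nat.coprime_one_left n
  obtain ⟨M, hM, ⟨e⟩⟩ := exists_isotypic_splitting hζ hn hq U hU
  -- the value of `-1`
  obtain ⟨m, rfl⟩ : ∃ m, n = m + 1 := ⟨n - 1, by have := NeZero.ne n; omega⟩
  have hneg : ((-1 : ZMod (m + 1))).val = m := ZMod.val_neg_one m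
  have hmpos : 0 < m := by omega
  set b : ZMod (m + 1) := -1 with hb
  -- the uniform staircase resolution `Ω M_a ≅ M_{-1}^{a}`
  have hK : ∀ a : ZMod (m + 1), IsSyzygy 1 (@ModuleCat.of U _ (M a) _ (M a).module)
      (ModuleCat.of U (Π _ : Fin a.val, M b)) := by
    intro a
    have ha : a.val < m + 1 := a.val_lt
    refine isSyzygy_one_staircase_of_lt hζ U hU M hM a a.val (fun s => a.val - min s a.val) (fun s => min s a.val)
      ?_ ?_ ?_ (fun _ => b) ?_ ?_
    · exact fun s t h => Nat.sub_le_sub_left (min_le_min_right a.val h) a.val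
    · exact fun s t h => min_le_min_right a.val h
    · intro s
      rw [one_mul, Nat.sub_add_cancel (min_le_right s a.val), ZMod.natCast_zmod_val]
    · intro t ht
      rw [min_eq_left (le_of_lt ht), min_eq_left ht, one_mul, show a.val - t + (t + 1) = a.val + 1 by omega,
        Nat.cast_add, ZMod.natCast_zmod_val, Nat.cast_one]
      ring
    · refine isotypic_le_span_of_cover hζ U hU M hM a a.val a.val (fun s => a.val - min s a.val)
        (fun s => min s a.val) ?_ ?_ ?_
      · intro s
        rw [one_mul, Nat.sub_add_cancel (min_le_right s a.val), ZMod.natCast_zmod_val]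
      · rw [one_mul, ZMod.natCast_zmod_val]
      · intro i hi
        refine ⟨i, hi, (min_le_left _ _), ?_⟩
        have hival : ((i : ℕ) : ZMod (m + 1)).val = i := by
          rw [ZMod.val_natCast]; exact Nat.mod_eq_of_lt (by omega)
        rw [min_eq_left hi, one_mul, ZMod.val_sub (by rw [hival]; exact hi), hival]
  -- the certificate data: distinguished family = the single piece `M_{-1}`
  let M' : ZMod (m + 1) → ModuleCat.{u} U := fun a => @ModuleCat.of U _ (M a) _ (M a).module
  let K : ZMod (m + 1) → ModuleCat.{u} U := fun a => ModuleCat.of U (Π _ : Fin a.val, M b)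
  let ψ : Unit → ZMod (m + 1) := fun _ => b
  have hKD : ∀ a, IsRetractOfPower (ModuleCat.of U ((Π t, M' (ψ t)) × U)) (K a) := by
    intro a
    refine IsRetractOfPower.piFamily (fun _ : Fin a.val => M' b) fun _ => ?_
    exact (isRetractOfPower_fst (ModuleCat.of U (Π t, M' (ψ t))) (ModuleCat.of U U)).of_isRetractOfPower_gen
      (isRetractOfPower_eval (fun t : Unit => M' (ψ t)) ())
  have hD : ∀ t, ∃ (s : Unit) (i : M' (ψ t) ⟶ K (ψ s)) (r : K (ψ s) ⟶ M' (ψ t)), i ≫ r = 𝟙 (M' (ψ t)) := by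
    intro t
    let i₀ : Fin b.val := ⟨0, by rw [hneg]; exact hmpos⟩
    refine ⟨(),
      @ModuleCat.ofHom U _ (M b) (Π _ : Fin b.val, M b)
        _ (M b).module _ _ (LinearMap.single U (fun _ : Fin b.val => M b) i₀),
      @ModuleCat.ofHom U _ (Π _ : Fin b.val, M b) (M b)
        _ _ _ (M b).module (LinearMap.proj i₀), ?_⟩
    apply ModuleCat.hom_ext
    refine LinearMap.ext fun x => ?_
    change (Pi.single i₀ x : Π _ : Fin b.val, ↥(M b)) i₀ = x
    exact Pi.single_eq_same _ _
  have hfin : ∀ t, Module.Finite U (M' (ψ t)) := fun _ => finite_isotypic hζ 1 U hU M hM b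
  obtain ⟨h4, hiff⟩ := @cohomologyAnnihilator_eq_four_of_isotypicData k _ (m + 1) _ ζ hζ hn 1 hq U hU Unit _ M' e
    K hK ψ hfin hKD hD
  exact ⟨M, hM, h4, fun x => (hiff x).trans ⟨fun h => h (), fun h _ => h⟩⟩

end Summit.ResolutionOfSingularities.ResolutionOfSingularities.Theorems.HomologicalConductor.PersistenceCyclicQuotientVeronese

end
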